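import Literature.Algebra.Module.ThreeTermComplexExchangeLocus
import Mathlib.RingTheory.Localization.FractionRing
import HarnessLib

/-!
# Generic cohomology and base change over a domain: the exchange locus and the generic Betti stratum are dense open
# neighbourhoods of the generic point (Hartshorne III 12.8–12.11; EGA III 7.8.4; Mumford, *Abelian Varieties*, §5)

Topic `Algebra/Module`; namespace `Literature.Algebra.Module`; theorems only (no definition, named fact, instance, notation,
`sorry`; Mathlib + ★ `Algebra/Module/ThreeTermComplexExchangeLocus`). For a window `K⁰ —f→ K¹ —g→ K²` (`g ∘ f = 0`) with `K¹`
finite and `K²` finite projective over a DOMAIN `A` with generic point `η = (0)`: the fibre Betti number of ★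
`FibreBettiNumberSemicontinuity` takes its MINIMUM `b(η)` at the generic point and EQUALS `b(η)` on an OPEN (hence dense)
neighbourhood of `η` (upper semicontinuity, ★ `isOpen_setOf_finrank_betti_baseChange_lt` + ★
`apply_bot_le_of_isOpen_setOf_lt`); and the EXCHANGE LOCUS of ★ `ThreeTermComplexExchangeLocus` (`= freeLocus (coker g)`,
open) CONTAINS `η` — at the generic point every finite module is free, `(coker g)_η` being a vector space over `A_η = Frac A`
— hence is a dense open set on which cohomology commutes with base change: «generically, `Rⁱf_*𝓕 ⊗ k(y) → Hⁱ(X_y, 𝓕_y)` is an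
isomorphism and `hⁱ(y)` is constant» (the generic case of Hartshorne III Cor. 12.9 ∕ EGA III 7.8.4; the dense-open form of
Mumford §5).

* `finrank_betti_baseChange_bot_le` — `b(η) ≤ b(𝔭)` for every prime (the generic Betti number is the minimum);
* **`isOpen_setOf_finrank_betti_baseChange_eq_bot`**, `bot_mem_setOf_finrank_betti_baseChange_eq_bot`,
  `dense_setOf_finrank_betti_baseChange_eq_bot` — the generic stratum `{𝔭 ; b(𝔭) = b(η)}` is OPEN, contains `η`, and is DENSE;
* `bot_mem_freeLocus` — over a domain the generic point lies in the free locus of EVERY module (`M_η` is a `Frac A`-vector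
  space; the `Field` structure on `Localization.AtPrime ⊥` by Mathlib `IsFractionRing.toField`, the pattern of ★
  `RingTheory/KrullDimension/GenericFlatness.exists_projective_localizedModule_away`);
* **`ker_baseChange_residueField_bot_le`** — the exchange criterion HOLDS AT THE GENERIC POINT (★
  `mem_freeLocus_coker_iff_ker_baseChange_residueField_le`); **`dense_setOf_ker_baseChange_residueField_le`** — the exchange
  locus is a DENSE OPEN subset of `Spec A` (`dense_of_bot_mem`: any set containing `η` is dense, Mathlib
  `specializes_iff_mem_closure`).

What is NOT here: noetherian refinements (`coker g` projective over some `A_s`, `s ≠ 0` — ★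
`GenericFlatness.exists_projective_localizedModule_away` for a noetherian domain, or Mathlib
`Module.FinitePresentation.exists_free_localizedModule_powers`; not restated), reduced non-domains (finitely many generic
points), the scheme form. Library only (cell `pub-hodge-ring2`, count-neutral); proves nothing about any crux, route or
conjecture.

## References

* R. Hartshorne, *Algebraic Geometry*, GTM 52 (1977), III Thm. 12.8, Cor. 12.9, Thm. 12.11 (pp. 288–290; held PDF pp. 349–351).
  [Hartshorne1977]
* A. Grothendieck, EGA III₂ (1963), 7.8.4; EGA IV₃ (1966), 9.4. [EGAIII2]
-/

universe u
open TensorProduct Module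

namespace Literature.Algebra.Module

section Generic

variable {A : Type u} [CommRing A] [IsDomain A]

/-- Over a domain, a subset of `Spec A` containing the generic point `(0)` is DENSE: `(0)` specialises to every prime (Mathlib
`PrimeSpectrum.le_iff_specializes`, `specializes_iff_mem_closure`; the topological dual of Mathlib's
`PrimeSpectrum.closure_singleton` ∕ the generic-point instance `PrimeSpectrum.irreducibleSpace`). [cite: Hartshorne1977, III
Cor. 12.9, proof (p. 289)] -/
theorem dense_of_bot_mem {s : Set (PrimeSpectrum A)} (hs : (⟨⊥, Ideal.isPrime_bot⟩ : PrimeSpectrum A) ∈ s) : Dense s := by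
  intro p
  have hsp : (⟨⊥, Ideal.isPrime_bot⟩ : PrimeSpectrum A) ⤳ p :=
    (PrimeSpectrum.le_iff_specializes _ _).1 (fun x hx => by
      change x ∈ (⊥ : Ideal A) at hx; rw [Ideal.mem_bot] at hx; rw [hx]; exact p.asIdeal.zero_mem)
  exact closure_mono (Set.singleton_subset_iff.2 hs) (specializes_iff_mem_closure.1 hsp)

/-- **Over a domain the generic point lies in the free locus of every module**: `M_η = M ⊗ Frac A` is a vector space over the
field `A_η = Frac A` (Mathlib `IsFractionRing.toField` on `Localization.AtPrime ⊥`, `Module.Free.of_divisionRing`; the pattern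
of ★ `RingTheory/KrullDimension/GenericFlatness.exists_projective_localizedModule_away`). [folklore] [cite: Hartshorne1977,
III Cor. 12.9, proof (p. 289)] -/
theorem bot_mem_freeLocus (M : Type u) [AddCommGroup M] [Module A M] :
    (⟨⊥, Ideal.isPrime_bot⟩ : PrimeSpectrum A) ∈ Module.freeLocus A M := by
  -- adapted from ★ `Literature.RingTheory.KrullDimension.exists_projective_localizedModule_away`
  rw [Module.mem_freeLocus]
  haveI : IsLocalization (nonZeroDivisors A) (Localization.AtPrime (⊥ : Ideal A)) := by
    rw [← Ideal.primeCompl_bot]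
    infer_instance
  letI : Field (Localization.AtPrime (⊥ : Ideal A)) := IsFractionRing.toField A
  change Module.Free (Localization.AtPrime (⊥ : Ideal A)) (LocalizedModule (⊥ : Ideal A).primeCompl M)
  exact Module.Free.of_divisionRing _ _

variable {K0 K1 K2 : Type u} [AddCommGroup K0] [Module A K0] [AddCommGroup K1] [Module A K1]
  [AddCommGroup K2] [Module A K2] [Module.Finite A K1] [Module.Finite A K2] [Module.Projective A K2]
  {f : K0 →ₗ[A] K1} {g : K1 →ₗ[A] K2} (hfg : g ∘ₗ f = 0)
include hfg

/-- **The generic Betti number is the minimum**: `b(η) ≤ b(𝔭)` for every prime `𝔭` of a domain (upper semicontinuity, ★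
`isOpen_setOf_finrank_betti_baseChange_lt`, and the generic point lies in every non-empty open set, ★
`apply_bot_le_of_isOpen_setOf_lt`). [cite: Hartshorne1977, III Thm. 12.8 (p. 288)] -/
theorem finrank_betti_baseChange_bot_le (p : PrimeSpectrum A) :
    finrank (⟨⊥, Ideal.isPrime_bot⟩ : PrimeSpectrum A).asIdeal.ResidueField
        ((LinearMap.ker (g.baseChange (⟨⊥, Ideal.isPrime_bot⟩ : PrimeSpectrum A).asIdeal.ResidueField)).map
          (LinearMap.range (f.baseChange (⟨⊥, Ideal.isPrime_bot⟩ : PrimeSpectrum A).asIdeal.ResidueField)).mkQ) ≤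
      finrank p.asIdeal.ResidueField ((LinearMap.ker (g.baseChange p.asIdeal.ResidueField)).map
        (LinearMap.range (f.baseChange p.asIdeal.ResidueField)).mkQ) :=
  apply_bot_le_of_isOpen_setOf_lt (fun q : PrimeSpectrum A => finrank q.asIdeal.ResidueField
      ((LinearMap.ker (g.baseChange q.asIdeal.ResidueField)).map (LinearMap.range (f.baseChange q.asIdeal.ResidueField)).mkQ))
    (isOpen_setOf_finrank_betti_baseChange_lt hfg) p

/-- **The generic Betti stratum `{𝔭 ; b(𝔭) = b(η)}` is OPEN** (it is `{b < b(η) + 1}` by minimality). [cite: Hartshorne1977, III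
Thm. 12.8 (p. 288)] -/
theorem isOpen_setOf_finrank_betti_baseChange_eq_bot :
    IsOpen {p : PrimeSpectrum A | finrank p.asIdeal.ResidueField ((LinearMap.ker (g.baseChange p.asIdeal.ResidueField)).map
        (LinearMap.range (f.baseChange p.asIdeal.ResidueField)).mkQ) =
      finrank (⟨⊥, Ideal.isPrime_bot⟩ : PrimeSpectrum A).asIdeal.ResidueField
        ((LinearMap.ker (g.baseChange (⟨⊥, Ideal.isPrime_bot⟩ : PrimeSpectrum A).asIdeal.ResidueField)).map
          (LinearMap.range (f.baseChange (⟨⊥, Ideal.isPrime_bot⟩ : PrimeSpectrum A).asIdeal.ResidueField)).mkQ)} := by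
  have hset : {p : PrimeSpectrum A | finrank p.asIdeal.ResidueField ((LinearMap.ker (g.baseChange p.asIdeal.ResidueField)).map
        (LinearMap.range (f.baseChange p.asIdeal.ResidueField)).mkQ) =
      finrank (⟨⊥, Ideal.isPrime_bot⟩ : PrimeSpectrum A).asIdeal.ResidueField
        ((LinearMap.ker (g.baseChange (⟨⊥, Ideal.isPrime_bot⟩ : PrimeSpectrum A).asIdeal.ResidueField)).map
          (LinearMap.range (f.baseChange (⟨⊥, Ideal.isPrime_bot⟩ : PrimeSpectrum A).asIdeal.ResidueField)).mkQ)} =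
      {p : PrimeSpectrum A | finrank p.asIdeal.ResidueField ((LinearMap.ker (g.baseChange p.asIdeal.ResidueField)).map
        (LinearMap.range (f.baseChange p.asIdeal.ResidueField)).mkQ) <
      finrank (⟨⊥, Ideal.isPrime_bot⟩ : PrimeSpectrum A).asIdeal.ResidueField
        ((LinearMap.ker (g.baseChange (⟨⊥, Ideal.isPrime_bot⟩ : PrimeSpectrum A).asIdeal.ResidueField)).map
          (LinearMap.range (f.baseChange (⟨⊥, Ideal.isPrime_bot⟩ : PrimeSpectrum A).asIdeal.ResidueField)).mkQ) + 1} := by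
    ext p
    have := finrank_betti_baseChange_bot_le hfg p
    dsimp only at this
    simp only [Set.mem_setOf_eq]
    omega
  rw [hset]
  exact isOpen_setOf_finrank_betti_baseChange_lt hfg _

omit [Module.Finite A K1] [Module.Finite A K2] [Module.Projective A K2] hfg in
/-- The generic stratum contains the generic point (trivially) and is therefore DENSE. [cite: Hartshorne1977, III Thm. 12.8 (p.
288)] -/
theorem dense_setOf_finrank_betti_baseChange_eq_bot :
    Dense {p : PrimeSpectrum A | finrank p.asIdeal.ResidueField ((LinearMap.ker (g.baseChange p.asIdeal.ResidueField)).map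
        (LinearMap.range (f.baseChange p.asIdeal.ResidueField)).mkQ) =
      finrank (⟨⊥, Ideal.isPrime_bot⟩ : PrimeSpectrum A).asIdeal.ResidueField
        ((LinearMap.ker (g.baseChange (⟨⊥, Ideal.isPrime_bot⟩ : PrimeSpectrum A).asIdeal.ResidueField)).map
          (LinearMap.range (f.baseChange (⟨⊥, Ideal.isPrime_bot⟩ : PrimeSpectrum A).asIdeal.ResidueField)).mkQ)} :=
  dense_of_bot_mem rfl

/-- **The exchange criterion holds at the generic point of a domain**: `φ(κ(η))` is surjective (★
`mem_freeLocus_coker_iff_ker_baseChange_residueField_le` and `bot_mem_freeLocus`) — «generically, cohomology commutes with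
base change». [cite: Hartshorne1977, III Thm. 12.11 (a) (p. 290)] -/
theorem ker_baseChange_residueField_bot_le :
    LinearMap.ker (g.baseChange (⟨⊥, Ideal.isPrime_bot⟩ : PrimeSpectrum A).asIdeal.ResidueField) ≤
      LinearMap.range ((LinearMap.ker g).subtype.baseChange (⟨⊥, Ideal.isPrime_bot⟩ : PrimeSpectrum A).asIdeal.ResidueField) ⊔
        LinearMap.range (f.baseChange (⟨⊥, Ideal.isPrime_bot⟩ : PrimeSpectrum A).asIdeal.ResidueField) :=
  (mem_freeLocus_coker_iff_ker_baseChange_residueField_le hfg _).1 (bot_mem_freeLocus _)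

/-- **The exchange locus of a window over a domain is a DENSE OPEN set** (★ `isOpen_setOf_ker_baseChange_residueField_le` + the
generic point). [cite: Hartshorne1977, III Thm. 12.11 (a) (p. 290)] -/
theorem dense_setOf_ker_baseChange_residueField_le :
    Dense {p : PrimeSpectrum A | LinearMap.ker (g.baseChange p.asIdeal.ResidueField) ≤
      LinearMap.range ((LinearMap.ker g).subtype.baseChange p.asIdeal.ResidueField) ⊔
        LinearMap.range (f.baseChange p.asIdeal.ResidueField)} :=
  dense_of_bot_mem (ker_baseChange_residueField_bot_le hfg)

end Generic

end Literature.Algebra.Module
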